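import Summits.ResolutionOfSingularities.ResolutionOfSingularities.Theorems.WeightedInvariantELadderOneDisjoint
import Literature.AlgebraicGeometry.Resolution.RegularQuotientIdeal
import Literature.AlgebraicGeometry.Resolution.RegularLocalRingsProofs
import Literature.AlgebraicGeometry.Resolution.StrictNormalCrossingsAt
import Mathlib.RingTheory.Ideal.KrullsHeightTheorem
import HarnessLib

/-!
# Chart parameters independent at a point of the orbit closure cut out the orbit closure near that point

Route `ResolutionOfSingularities/WeightedInvariant`, door crux `HypersurfaceCentreConstruction`
(stmt-ResolutionOfSingularities-19897) — OURS, helper; e-ladder `e = 1`, registered stub `stub_e1_centre` of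
`res-L1-w43-stub-10` (cell res-hironaka, `D/res-D-pv-025/DOOR-ELADDER-PLAN.md` §7–§8, sub-lemma **L0-charts**, step
«the local component of `V(f₀, f₁)` at a point of `𝒬 = closure {η}` is `𝒬`»).

Setting: `W` an affine open of a locally Noetherian scheme `Y`, `η ∈ W` a point whose local ring is (regular) of
dimension `2`, `y ∈ W ∩ closure {η}`, and sections `f₀, f₁ ∈ 𝔭_η ⊆ Γ(Y, W)` (vanishing on `𝒬`) which are part of a
regular system of parameters AT `y`.  Then `(f₀, f₁)·𝒪_{Y,y} = 𝔭_η·𝒪_{Y,y}` (`span_germ_pair_eq_map_primeIdealOf`):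
`(f₀, f₁)𝒪_y` is a prime of height `≥ 2` (chain `0 ⊊ (f₀) ⊊ (f₀, f₁)` of primes, Matsumura 14.2/14.3) inside the prime
`𝔭_η 𝒪_y` of height `ht 𝔭_η = dim 𝒪_{Y,η} = 2`.  Consequently (`exists_basicOpen_zero_subset_closure`) there is a
basic open `D(s) ∋ y` of `W` on which every common zero of `f₀, f₁` lies in `closure {η}` — the hypothesis `hcl` of
the chart lemma `germContractionIdeal_weightedMonomialIdeal_germ_eq` (file `…GermContractionChart`) on the affine
neighbourhood `D(s)` of `y`.

* `span_eq_of_height_le_two` — local algebra: in a regular local ring, two elements of a prime `P` of height `≤ 2`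
  with independent differentials generate `P`;
* `span_germ_pair_eq_map_primeIdealOf` — the scheme reading at `y ∈ closure {η}`;
* `exists_basicOpen_zero_subset_closure`, `exists_affineOpen_zero_subset_closure` — the neighbourhood `D(s)`.

No named facts. AI-written; weaker than expert review.
-/

noncomputable section

set_option linter.dupNamespace false -- mandated namespace of this single-conjunct summit

namespace Summit.ResolutionOfSingularities.ResolutionOfSingularities.Theorems

universe u

open CategoryTheory AlgebraicGeometry TopologicalSpace IsLocalRing Opposite
open Literature.AlgebraicGeometry.Resolution

/-! ## Local algebra: two independent parameters inside a prime of height two generate it -/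

/-- **In a regular local ring, two elements with independent differentials lying in a prime `P` of height `≤ 2`
generate `P`**: `(f₀, f₁)` is prime (Matsumura 14.2/14.3) of height `≥ 2` (`0 ⊊ (f₀) ⊊ (f₀, f₁)`), and a prime
of finite height equals any ideal above it of no greater height. [cite: Matsumura1987, Thm. 14.2] -/
theorem span_eq_of_height_le_two {O : Type u} [CommRing O] [IsRegularLocalRing O] (f : Fin 2 → O)
    (hf : ∀ i, f i ∈ maximalIdeal O)
    (hli : LinearIndependent (ResidueField O) fun i => (maximalIdeal O).toCotangent ⟨f i, hf i⟩)
    {P : Ideal O} [P.IsPrime] (hfP : ∀ i, f i ∈ P) (hP : P.height ≤ 2) :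
    Ideal.span (Set.range f) = P := by
  haveI : IsDomain O := isDomain_of_isRegularLocalRing O
  -- the two primes `(f₀) ⊊ (f₀, f₁)`
  haveI hQ : (Ideal.span (Set.range f)).IsPrime := by
    have := isPrime_span_image_of_linearIndependent_toCotangent f hf hli Set.univ
    rwa [Set.image_univ] at this
  haveI hQ0 : (Ideal.span {f 0}).IsPrime := by
    have := isPrime_span_image_of_linearIndependent_toCotangent f hf hli {0}
    rwa [Set.image_singleton] at this
  have hrel := (linearIndependent_toCotangent_iff_forall_mem f hf).mp hli
  have hf0 : f 0 ≠ 0 := by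
    intro h0
    have h := hrel (Pi.single 0 1) (by simp [Fin.sum_univ_two, h0]) 0
    simp only [Pi.single_eq_same] at h
    exact (maximalIdeal.isMaximal O).ne_top (Ideal.eq_top_of_isUnit_mem _ h isUnit_one)
  have hf1 : f 1 ∉ Ideal.span {f 0} := by
    intro h1
    obtain ⟨a, ha⟩ := Ideal.mem_span_singleton'.mp h1
    have h := hrel ![-a, 1] (by simp [Fin.sum_univ_two, ← ha]) 1
    simp only [Matrix.cons_val_one, Matrix.cons_val_zero] at h
    exact (maximalIdeal.isMaximal O).ne_top (Ideal.eq_top_of_isUnit_mem _ h isUnit_one)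
  have hlt0 : (⊥ : Ideal O) < Ideal.span {f 0} :=
    bot_lt_iff_ne_bot.mpr (by simpa [Ideal.span_singleton_eq_bot] using hf0)
  have hlt1 : Ideal.span {f 0} < Ideal.span (Set.range f) := by
    refine lt_of_le_of_ne (Ideal.span_mono (Set.singleton_subset_iff.mpr ⟨0, rfl⟩)) fun h => hf1 ?_
    rw [h]; exact Ideal.subset_span ⟨1, rfl⟩
  -- heights
  have h1 : (1 : ℕ∞) ≤ (Ideal.span {f 0}).height := by
    have := Ideal.height_add_one_le_of_lt_of_isPrime hlt0
    rwa [Ideal.height_bot, zero_add] at this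
  have h2 : (2 : ℕ∞) ≤ (Ideal.span (Set.range f)).height := by
    have := Ideal.height_add_one_le_of_lt_of_isPrime hlt1
    calc (2 : ℕ∞) = 1 + 1 := by norm_num
      _ ≤ (Ideal.span {f 0}).height + 1 := add_le_add h1 le_rfl
      _ ≤ _ := this
  exact (Ideal.span (Set.range f)).eq_of_le_of_height_le (Ideal.span_le.mpr (Set.range_subset_iff.mpr hfP))
    (hP.trans h2)

/-! ## The scheme reading at a point of the orbit closure -/

section Scheme

variable {Y : Scheme.{u}} (W : Y.affineOpens) {η y : Y} (hηW : η ∈ (W : Y.Opens)) (hyW : y ∈ (W : Y.Opens))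

/-- The height of the prime of `η` in `Γ(Y, W)` is the dimension of `𝒪_{Y,η}`. [folklore] -/
theorem height_primeIdealOf_eq (n : ℕ) (hdim : ringKrullDim (Y.presheaf.stalk η) = (n : WithBot ℕ∞)) :
    ((W.2.primeIdealOf ⟨η, hηW⟩).asIdeal).height = n := by
  letI : Algebra Γ(Y, W) (Y.presheaf.stalk η) := TopCat.Presheaf.algebra_section_stalk Y.presheaf ⟨η, hηW⟩
  have hloc : IsLocalization.AtPrime (Y.presheaf.stalk η) (W.2.primeIdealOf ⟨η, hηW⟩).asIdeal :=
    W.2.isLocalization_stalk ⟨η, hηW⟩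
  have h := IsLocalization.AtPrime.ringKrullDim_eq_height (W.2.primeIdealOf ⟨η, hηW⟩).asIdeal
    (Y.presheaf.stalk η)
  rw [hdim] at h
  exact_mod_cast h.symm

/-- **At a point `y ∈ closure {η}` where `f₀, f₁ ∈ 𝔭_η` are part of a regular system of parameters,
`(f₀, f₁)·𝒪_{Y,y} = 𝔭_η·𝒪_{Y,y}`** (`𝒪_{Y,η}` of dimension `2`). [cite: Matsumura1987, Thm. 14.2] -/
theorem span_germ_pair_eq_map_primeIdealOf (hy : y ∈ closure ({η} : Set Y))
    [IsRegularLocalRing (Y.presheaf.stalk y)]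
    (hdim : ringKrullDim (Y.presheaf.stalk η) = ((2 : ℕ) : WithBot ℕ∞)) (f : Fin 2 → Γ(Y, W))
    (hfη : ∀ i, f i ∈ (W.2.primeIdealOf ⟨η, hηW⟩).asIdeal)
    (hfy : ∀ i, (Y.presheaf.germ (W : Y.Opens) y hyW).hom (f i) ∈ maximalIdeal (Y.presheaf.stalk y))
    (hli : LinearIndependent (ResidueField (Y.presheaf.stalk y))
      fun i => (maximalIdeal (Y.presheaf.stalk y)).toCotangent ⟨_, hfy i⟩) :
    Ideal.span (Set.range fun i => (Y.presheaf.germ (W : Y.Opens) y hyW).hom (f i)) =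
      ((W.2.primeIdealOf ⟨η, hηW⟩).asIdeal).map (Y.presheaf.germ (W : Y.Opens) y hyW).hom := by
  letI : Algebra Γ(Y, W) (Y.presheaf.stalk y) := TopCat.Presheaf.algebra_section_stalk Y.presheaf ⟨y, hyW⟩
  have hloc : IsLocalization.AtPrime (Y.presheaf.stalk y) (W.2.primeIdealOf ⟨y, hyW⟩).asIdeal :=
    W.2.isLocalization_stalk ⟨y, hyW⟩
  have hφ : (Y.presheaf.germ (W : Y.Opens) y hyW).hom = algebraMap Γ(Y, W) (Y.presheaf.stalk y) := rfl
  have hle := primeIdealOf_le_of_mem_closure W hηW hyW hy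
  have hdisj : Disjoint ((W.2.primeIdealOf ⟨y, hyW⟩).asIdeal.primeCompl : Set Γ(Y, W))
      ((W.2.primeIdealOf ⟨η, hηW⟩).asIdeal : Set Γ(Y, W)) :=
    Set.disjoint_left.mpr fun s hs hsη => hs (hle hsη)
  rw [hφ]
  haveI : (((W.2.primeIdealOf ⟨η, hηW⟩).asIdeal).map (algebraMap Γ(Y, W) (Y.presheaf.stalk y))).IsPrime :=
    IsLocalization.isPrime_of_isPrime_disjoint _ (Y.presheaf.stalk y) _ inferInstance hdisj
  have hheight : (((W.2.primeIdealOf ⟨η, hηW⟩).asIdeal).map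
      (algebraMap Γ(Y, W) (Y.presheaf.stalk y))).height = 2 := by
    rw [IsLocalization.height_map_of_disjoint (W.2.primeIdealOf ⟨y, hyW⟩).asIdeal.primeCompl _ hdisj]
    exact height_primeIdealOf_eq W hηW 2 hdim
  exact span_eq_of_height_le_two _ hfy hli (fun i => Ideal.mem_map_of_mem _ (hfη i)) hheight.le

/-- **The common zeros of `f₀, f₁` near `y` lie in `closure {η}`**: under the hypotheses of
`span_germ_pair_eq_map_primeIdealOf` (packaged as its conclusion), there is a basic open `D(s) ∋ y` of `W` such
that every point of `W ∩ D(s)` at which `f₀, f₁` vanish lies in `closure {η}` (finitely many generators of `𝔭_η`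
become multiples of `f₀, f₁` after inverting one `s ∉ 𝔭_y`). [folklore] -/
theorem exists_basicOpen_zero_subset_closure [IsLocallyNoetherian Y] (f : Fin 2 → Γ(Y, W))
    (heq : Ideal.span (Set.range fun i => (Y.presheaf.germ (W : Y.Opens) y hyW).hom (f i)) =
      ((W.2.primeIdealOf ⟨η, hηW⟩).asIdeal).map (Y.presheaf.germ (W : Y.Opens) y hyW).hom) :
    ∃ s : Γ(Y, W), y ∈ Y.basicOpen s ∧
      ∀ (z : Y) (hz : z ∈ (W : Y.Opens)), z ∈ Y.basicOpen s →
        (∀ i, (Y.presheaf.germ (W : Y.Opens) z hz).hom (f i) ∈ maximalIdeal (Y.presheaf.stalk z)) →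
        z ∈ closure ({η} : Set Y) := by
  classical
  letI : Algebra Γ(Y, W) (Y.presheaf.stalk y) := TopCat.Presheaf.algebra_section_stalk Y.presheaf ⟨y, hyW⟩
  have hloc : IsLocalization.AtPrime (Y.presheaf.stalk y) (W.2.primeIdealOf ⟨y, hyW⟩).asIdeal :=
    W.2.isLocalization_stalk ⟨y, hyW⟩
  have hφ : (Y.presheaf.germ (W : Y.Opens) y hyW).hom = algebraMap Γ(Y, W) (Y.presheaf.stalk y) := rfl
  haveI : IsNoetherianRing Γ(Y, W) := IsLocallyNoetherian.component_noetherian W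
  -- generators of `𝔭_η`
  obtain ⟨G, hG⟩ := (IsNoetherian.noetherian ((W.2.primeIdealOf ⟨η, hηW⟩).asIdeal) :
    ((W.2.primeIdealOf ⟨η, hηW⟩).asIdeal).FG)
  -- each generator is a multiple of `f` after inverting some `m_g ∉ 𝔭_y`
  have hspan : (Ideal.span (Set.range f)).map (algebraMap Γ(Y, W) (Y.presheaf.stalk y)) =
      ((W.2.primeIdealOf ⟨η, hηW⟩).asIdeal).map (algebraMap Γ(Y, W) (Y.presheaf.stalk y)) := by
    rw [← hφ, ← heq, Ideal.map_span, ← Set.range_comp]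
    rfl
  have hmult : ∀ g : Γ(Y, W), g ∈ (W.2.primeIdealOf ⟨η, hηW⟩).asIdeal →
      ∃ m ∈ (W.2.primeIdealOf ⟨y, hyW⟩).asIdeal.primeCompl, m * g ∈ Ideal.span (Set.range f) := by
    intro g hg
    have h1 : algebraMap Γ(Y, W) (Y.presheaf.stalk y) g ∈
        (Ideal.span (Set.range f)).map (algebraMap Γ(Y, W) (Y.presheaf.stalk y)) := by
      rw [hspan]; exact Ideal.mem_map_of_mem _ hg
    exact (IsLocalization.algebraMap_mem_map_algebraMap_iff (W.2.primeIdealOf ⟨y, hyW⟩).asIdeal.primeCompl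
      (Y.presheaf.stalk y) _ g).mp h1
  choose m hm hmg using hmult
  let s : Γ(Y, W) := ∏ g ∈ G.attach, m g.1 (hG ▸ Ideal.subset_span g.2)
  have hs : s ∈ (W.2.primeIdealOf ⟨y, hyW⟩).asIdeal.primeCompl :=
    prod_mem fun g _ => hm g.1 _
  refine ⟨s, ?_, fun z hz hzs hfz => ?_⟩
  · -- `y ∈ D(s)`
    rw [Y.mem_basicOpen s y hyW]
    have : s ∉ (W.2.primeIdealOf ⟨y, hyW⟩).asIdeal := hs
    rw [← germ_mem_maximalIdeal_iff_mem_primeIdealOf W hyW s] at this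
    simpa [mem_maximalIdeal, mem_nonunits_iff] using this
  · -- a common zero `z ∈ D(s)` of the `fᵢ`
    have hsz : s ∉ (W.2.primeIdealOf ⟨z, hz⟩).asIdeal := by
      rw [← germ_mem_maximalIdeal_iff_mem_primeIdealOf W hz s, mem_maximalIdeal, mem_nonunits_iff, not_not]
      exact (Y.mem_basicOpen s z hz).mp hzs
    have hfz' : Ideal.span (Set.range f) ≤ (W.2.primeIdealOf ⟨z, hz⟩).asIdeal :=
      Ideal.span_le.mpr (Set.range_subset_iff.mpr fun i =>
        (germ_mem_maximalIdeal_iff_mem_primeIdealOf W hz (f i)).mp (hfz i))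
    refine mem_closure_of_primeIdealOf_le W hηW hz ?_
    rw [← hG, Ideal.span_le]
    intro g hg
    have hmg' := hfz' (hmg g (hG ▸ Ideal.subset_span hg))
    rcases ((W.2.primeIdealOf ⟨z, hz⟩).isPrime.mem_or_mem hmg') with h | h
    · refine absurd ?_ hsz
      exact (Ideal.IsPrime.prod_mem_iff (p := (W.2.primeIdealOf ⟨z, hz⟩).asIdeal)).mpr
        ⟨⟨g, hg⟩, G.mem_attach _, h⟩
    · exact h

/-- The same with an AFFINE neighbourhood (`D(s)` as an affine open `≤ W`) and the vanishing condition read in the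
restricted sections — the hypothesis `hcl` of `germContractionIdeal_weightedMonomialIdeal_germ_eq` on it. [folklore] -/
theorem exists_affineOpen_zero_subset_closure [IsLocallyNoetherian Y] (f : Fin 2 → Γ(Y, W))
    (heq : Ideal.span (Set.range fun i => (Y.presheaf.germ (W : Y.Opens) y hyW).hom (f i)) =
      ((W.2.primeIdealOf ⟨η, hηW⟩).asIdeal).map (Y.presheaf.germ (W : Y.Opens) y hyW).hom) :
    ∃ (U : Y.affineOpens) (hUW : (U : Y.Opens) ≤ W), y ∈ (U : Y.Opens) ∧
      ∀ (z : Y) (hz : z ∈ (U : Y.Opens)),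
        (∀ i, (Y.presheaf.germ (U : Y.Opens) z hz).hom ((Y.presheaf.map (homOfLE hUW).op).hom (f i)) ∈
          maximalIdeal (Y.presheaf.stalk z)) →
        z ∈ closure ({η} : Set Y) := by
  obtain ⟨s, hys, hcl⟩ := exists_basicOpen_zero_subset_closure W hηW hyW f heq
  refine ⟨Y.affineBasicOpen s, Y.basicOpen_le s, hys, fun z hz hfz => ?_⟩
  refine hcl z (Y.basicOpen_le s hz) hz fun i => ?_
  have hle : ((Y.affineBasicOpen s : Y.affineOpens) : Y.Opens) ≤ (W : Y.Opens) := Y.basicOpen_le s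
  have hgerm : (Y.presheaf.germ ((Y.affineBasicOpen s : Y.affineOpens) : Y.Opens) z hz).hom
      ((Y.presheaf.map (homOfLE hle).op).hom (f i)) =
      (Y.presheaf.germ (W : Y.Opens) z (Y.basicOpen_le s hz)).hom (f i) :=
    TopCat.Presheaf.germ_res_apply Y.presheaf (homOfLE hle) z hz (f i)
  rw [← hgerm]
  exact hfz i

end Scheme

end Summit.ResolutionOfSingularities.ResolutionOfSingularities.Theorems

end
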